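import Mathlib.Data.Nat.Log
import Mathlib.Data.Nat.Find
import Mathlib.Data.Nat.Digits.Defs
import Mathlib.Data.Fintype.Pigeonhole
import Mathlib.Order.Filter.AtTopBot.Basic
import Literature.Computability.Cryptography.SIS
import HarnessLib

/-!
# Ajtai's SIS function as one concrete function `{0,1}* → {0,1}*`

Topic `Computability/Cryptography` (family `pqc`), namespace `Literature.SIS` (parameters and the
function) and `Literature.PQC` (facts). Second brick of the decomposition of the named fact
`Literature.Computability.Cryptography.owfExist_of_gapSVP_worstCaseHard` (`LatticeOWF.lean`; first brick `SIS.lean`, assembly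
in `LatticeOWFProofs.lean`): the SIS-function step "inverters of Ajtai's function give
average-case SIS′ solvers" (the existential named fact
`Literature.Computability.Cryptography.Ajtai1996_sisFunction_inverter_to_SIS'` of `LatticeOWF.lean`: "there is a
polynomial-time `g` with admissible parameters whose inverters give SIS′ solvers") is made
concrete: ONE explicit function `SIS.sisFunction` with explicit parameters, everything
elementary about them PROVED here, and the non-elementary remainder isolated as three named
facts about this function:

* parameters `SIS.logLen n = ⌊log₂ (2n+4)⌋ = ⌊log₂ (n+2)⌋ + 1`, bit width `SIS.bitWidth n = 16 · logLen n`,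
  modulus `SIS.modulus n = 2^{bitWidth n}` (a power of two: uniform bits give uniform
  residues; MR07 Thm. 5.23 has no parity condition), width `SIS.width n = 2 n · bitWidth n`
  (`= 2 n log₂ q`, compressing), norm bound `SIS.normBound n = width n + 1` (rational, `≥ √m`),
  key length `SIS.keyLen n = n · width n · bitWidth n + width n` (bits of a pair `(A, x)`),
  and the dimension read off an input length, `SIS.dimOf k = max {n ≤ k | keyLen n ≤ k}`;
* PROVED: `modulus`, `width`, `keyLen` polynomially bounded, `normBound` polynomially bounded
  and `≥ 1`, the Micciancio–Regev modulus condition `4 √m · n^{1.5} · β ≤ q` for these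
  parameters (`SIS.mrModulusCondition_params`), `keyLen (dimOf k) ≤ k`, `dimOf → ∞`, and the
  block structure `dimOf k = n ↔ keyLen n ≤ k < keyLen (n+1)` (`SIS.dimOf_eq_iff`,
  `SIS.keyLen_strictMono`, `SIS.dimOf_keyLen`);
* `SIS.sisFunction w`: parse `w ∈ {0,1}^k` as `(A, x, pad)` with `n = dimOf k`,
  `A ∈ ℤ_q^{n×m}` read from the first `n m t` bits (`t` bits per entry, little-endian),
  `x ∈ {0,1}^m` from the next `m` bits, `pad` the rest, and output the code
  `boolPair (encodeMatrix A) (boolPair (code of A x mod q) pad)` (Ajtai 1996; MR07 §5.1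
  family `H_{q,m,2}`; Goldreich 2001 §2.4.2 packaging of a collection into one function);
* PROVED, structure of preimages (`SIS.sisFunction_eq_iff`, `SIS.length_eq_of_sisFunction_eq`,
  `SIS.isSolution'_of_sisFunction_eq`): `sisFunction z = sisFunction w` iff `|z| = |w|`, same
  parsed key `A`, same padding and `A x' = A x (mod q)` for the parsed vectors; so a successful
  inverter returns `x' = x` or a collision, i.e. an SIS′ solution `x - x'` of norm `≤ √m`;
* NAMED FACTS (nothing asserted): `Literature.Computability.Cryptography.sisFunction_polyTimeComputable` (TM2 level:
  parsing, matrix–vector product mod `2^t`), `Literature.Computability.Cryptography.sisParams_isPolyTimeParams` (TM2 level),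
  and the probabilistic core `Literature.Computability.Cryptography.Ajtai1996_sisFunction_core` (an inverter of
  `sisFunction` succeeding with probability `≥ 1/kᶜ` at length `k` yields a PPT average-case
  SIS′ solver in dimension `dimOf k` with probability `≥ 1/(dimOf k)^{c'}`: MR07 §5.1 collision
  remark with `SIS.isSolution'_sub_of_collision`, second-preimage loss `qⁿ/2^m = 2^{-n t}`,
  and a uniformly guessed length in the block `dimOf⁻¹(n)`);
* PROVED: existence of SIS′ solutions for the concrete parameters (pigeonhole,
  `SIS.exists_isSolution'_params`, MR07 Lemma 5.2 / §5.1), the counting half of the core,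
  `SIS.card_filter_inv_hashFun_le` (any would-be
  inverter returns the input itself for at most `qⁿ` of the `2^m` inputs `x ∈ {0,1}^m`) and
  `SIS.card_filter_invert_le` / `SIS.prob_invert_le` (successful inversions are self-returns
  or collisions: `Pr_x[x - x' solves SIS′_{√m}] ≥ Pr_x[inversion] - qⁿ/2^m`).

The assembly — these parameter lemmas and the three facts give the existential interface
`Literature.Computability.Cryptography.Ajtai1996_sisFunction_inverter_to_SIS'` of `LatticeOWF.lean`, hence (with
Micciancio–Regev's Thm. 5.23) `owfExist_of_gapSVP_worstCaseHard` — is the theorem-only sibling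
`LatticeOWFProofs.lean`; the probabilistic core `Ajtai1996_sisFunction_core` is proved, up to
the running time of the explicit reduction, in the sibling `SISFunctionSolver.lean`. This file
deliberately imports `SIS.lean` only.

## References

* M. Ajtai, *Generating hard instances of lattice problems*, STOC 1996, Thm. 1 (the function
  `x ↦ A x mod q` on `{0,1}^m`).
* D. Micciancio, O. Regev, *Worst-case to average-case reductions based on Gaussian measures*,
  SIAM J. Comput. 37 (2007); full version §5.1 (p. 18, family `H_{q,m,d}`, collisions),
  Thm. 5.23 (p. 28).
* O. Goldreich, *Foundations of Cryptography I*, CUP 2001, §2.4.1 (length conventions),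
  §2.4.2 (one-way collections as single functions), Def. 2.2.1.
* S. Arora, B. Barak, *Computational Complexity*, CUP 2009, §0.1 (encodings), §1.6.
-/

noncomputable section

open Filter Computability Literature.Computability.Complexity Literature.Computability.Cryptography Literature.Computability.Cryptography.LWE

namespace Literature.Computability.Cryptography

namespace SIS

/-! ### Concrete parameters -/

/-- `logLen n = ⌊log₂ (2n + 4)⌋ = ⌊log₂ (n + 2)⌋ + 1`, so that `n + 2 < 2^{logLen n} ≤ 2 (n + 2)`
and `logLen n ≥ 2`. (Written with `2n + 4` inside the logarithm rather than `+ 1` outside: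
an exposed successor in the exponent of `modulus n = 2^{16 logLen n}` makes definitional
unfolding of `ZMod (modulus n)` explode.) [Arora–Barak 2009, §0.1] [cite: AroraBarak2009, §0.1] -/
def logLen (n : ℕ) : ℕ := Nat.log 2 (2 * n + 4)

/-- Bit width of a residue: `t(n) = 16 · logLen n` (the constant `16` makes the
Micciancio–Regev modulus condition hold for every `n`, `mrModulusCondition_params`).
[Micciancio–Regev 2007, Thm. 5.23 (`q ≥ 4 √m n^{1.5} β`)] [cite: MicciancioRegev2007, Thm. 5.23] -/
def bitWidth (n : ℕ) : ℕ := 16 * logLen n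

/-- The modulus `q(n) = 2^{t(n)}`, a polynomially bounded power of two.
[Micciancio–Regev 2007, Thm. 5.23; Ajtai 1996, Thm. 1] [cite: MicciancioRegev2007, Thm. 5.23] -/
def modulus (n : ℕ) : ℕ := 2 ^ bitWidth n

/-- The width `m(n) = 2 n t(n) = 2 n log₂ q(n)` (a compressing choice: `2^m = q^{2n}`).
[Micciancio–Regev 2007, §5.1 ("m(n) > n log₂ q(n)"); Ajtai 1996, Thm. 1] [cite: MicciancioRegev2007, §5.1] -/
def width (n : ℕ) : ℕ := 2 * n * bitWidth n

/-- The norm bound `β(n) = m(n) + 1` (rational and `≥ √m(n)`, so binary collisions, of norm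
`≤ √m`, are SIS′_{q,m,β} solutions; `≥ 1`). [Micciancio–Regev 2007, §5.1 and Thm. 5.23] [cite: MicciancioRegev2007, §5.1] -/
def normBound (n : ℕ) : ℝ := width n + 1

/-- The number of input bits encoding a pair `(A, x)`, `A ∈ ℤ_q^{n×m}` (`t` bits per entry),
`x ∈ {0,1}^m`: `keyLen n = n m t + m`. [Goldreich 2001, §2.4.1–2.4.2] [cite: Goldreich2001, §2.4.2] -/
def keyLen (n : ℕ) : ℕ := n * width n * bitWidth n + width n

/-- The dimension used at input length `k`: the largest `n ≤ k` with `keyLen n ≤ k`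
(`keyLen 0 = 0`, so this is well defined; `keyLen n ≥ n`). [Goldreich 2001, §2.4.1 (length
conventions)] [cite: Goldreich2001, §2.4.1] -/
def dimOf (k : ℕ) : ℕ := Nat.findGreatest (fun n => keyLen n ≤ k) k

/-- The modulus is never zero. [folklore] -/
instance modulus_neZero (n : ℕ) : NeZero (modulus n) := ⟨pow_ne_zero _ two_ne_zero⟩

/-- `2 ≤ logLen n` (`4 ≤ 2n + 4`). [folklore] -/
theorem two_le_logLen (n : ℕ) : 2 ≤ logLen n :=
  Nat.le_log_of_pow_le one_lt_two (by omega)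

/-- `n + 2 < 2 ^ logLen n`. [Mathlib `Nat.lt_pow_succ_log_self`] [folklore] -/
theorem lt_two_pow_logLen (n : ℕ) : n + 2 < 2 ^ logLen n := by
  have h := Nat.lt_pow_succ_log_self one_lt_two (2 * n + 4)
  rw [Nat.pow_succ] at h
  unfold logLen
  omega

/-- `2 ^ logLen n ≤ 2 (n + 2)`. [Mathlib `Nat.pow_log_le_self`] [folklore] -/
theorem two_pow_logLen_le (n : ℕ) : 2 ^ logLen n ≤ 2 * (n + 2) := by
  have := Nat.pow_log_le_self 2 (x := 2 * n + 4) (by omega)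
  unfold logLen
  omega

/-- `logLen n ≤ 2 n + 4`. [folklore] -/
theorem logLen_le (n : ℕ) : logLen n ≤ 2 * n + 4 := by
  have h1 := (logLen n).lt_two_pow_self
  have h2 := two_pow_logLen_le n
  omega

/-- `16 ≤ bitWidth n` (in particular `1 ≤ bitWidth n`). [folklore] -/
theorem sixteen_le_bitWidth (n : ℕ) : 16 ≤ bitWidth n := by
  unfold bitWidth; have := two_le_logLen n; omega

/-- `n ≤ keyLen n`. [folklore] -/
theorem le_keyLen (n : ℕ) : n ≤ keyLen n := by
  unfold keyLen width
  have ht := sixteen_le_bitWidth n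
  calc n ≤ 2 * n * bitWidth n := by nlinarith
    _ ≤ n * (2 * n * bitWidth n) * bitWidth n + 2 * n * bitWidth n := Nat.le_add_left _ _

/-- `keyLen (dimOf k) ≤ k`: the parse of `(A, x)` fits into the input. [Goldreich 2001,
§2.4.1] [cite: Goldreich2001, §2.4.1] -/
theorem keyLen_dimOf_le (k : ℕ) : keyLen (dimOf k) ≤ k :=
  Nat.findGreatest_spec (P := fun n => keyLen n ≤ k) (Nat.zero_le k) (by simp [keyLen, width])

/-- Every dimension whose key length fits is at most `dimOf k`. [Goldreich 2001, §2.4.1] [cite: Goldreich2001, §2.4.1] -/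
theorem le_dimOf {n k : ℕ} (h : keyLen n ≤ k) : n ≤ dimOf k :=
  Nat.le_findGreatest ((le_keyLen n).trans h) h

/-- The dimension tends to infinity with the input length. [Goldreich 2001, §2.4.1] [cite: Goldreich2001, §2.4.1] -/
theorem tendsto_dimOf : Tendsto dimOf atTop atTop :=
  tendsto_atTop_atTop.2 fun N => ⟨keyLen N, fun _ hk => le_dimOf hk⟩

/-- The modulus is polynomially bounded: `2^{16 logLen n} ≤ (2n + 4)^{16}`.
[Micciancio–Regev 2007, Thm. 5.23 (`q(n) = n^{O(1)}`)] [cite: MicciancioRegev2007, Thm. 5.23] -/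
theorem isPolyBounded_modulus : IsPolyBounded modulus := by
  refine ⟨(2 * Polynomial.X + 4) ^ 16, fun n => ?_⟩
  simp only [Polynomial.eval_pow, Polynomial.eval_add, Polynomial.eval_mul, Polynomial.eval_X,
    Polynomial.eval_ofNat, modulus, bitWidth]
  rw [mul_comm 16, pow_mul]
  exact Nat.pow_le_pow_left (by have := two_pow_logLen_le n; omega) 16

/-- The width is polynomially bounded: `2 n · 16 logLen n ≤ 32 n (2n + 4)`.
[Micciancio–Regev 2007, Thm. 5.23 (`m(n) = n^{O(1)}`)] [cite: MicciancioRegev2007, Thm. 5.23] -/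
theorem isPolyBounded_width : IsPolyBounded width := by
  refine ⟨32 * Polynomial.X * (2 * Polynomial.X + 4), fun n => ?_⟩
  simp only [Polynomial.eval_add, Polynomial.eval_mul, Polynomial.eval_X,
    Polynomial.eval_ofNat, width, bitWidth]
  have := logLen_le n
  calc 2 * n * (16 * logLen n) = 32 * n * logLen n := by ring
    _ ≤ 32 * n * (2 * n + 4) := Nat.mul_le_mul_left _ this

/-- `1 ≤ normBound n`. [Micciancio–Regev 2007, §5.1] [cite: MicciancioRegev2007, §5.1] -/
theorem one_le_normBound (n : ℕ) : 1 ≤ normBound n := by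
  unfold normBound
  have : (0 : ℝ) ≤ width n := Nat.cast_nonneg _
  linarith

/-- The norm bound is polynomially bounded. [Micciancio–Regev 2007, Thm. 5.23
(`β(n) = n^{O(1)}`)] [cite: MicciancioRegev2007, Thm. 5.23] -/
theorem isPolyBoundedReal_normBound : Literature.Algebra.EuclideanLattices.IsPolyBoundedReal normBound := by
  obtain ⟨p, hp⟩ := isPolyBounded_width
  refine ⟨p + 1, fun n => ?_⟩
  simp only [normBound, Polynomial.eval_add, Polynomial.eval_one, Nat.cast_add, Nat.cast_one]
  exact_mod_cast Nat.add_le_add_right (hp n) 1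

/-- `√m ≤ β`: binary collisions (norm `≤ √m`) are within the norm bound.
[Micciancio–Regev 2007, §5.1] [cite: MicciancioRegev2007, §5.1] -/
theorem sqrt_width_le_normBound (n : ℕ) : Real.sqrt (width n) ≤ normBound n := by
  unfold normBound
  rw [Real.sqrt_le_left (by positivity)]
  nlinarith [(Nat.cast_nonneg (width n) : (0 : ℝ) ≤ width n)]

/-- Real-arithmetic core of the modulus condition: `4 · x · y · z ≤ P¹⁶` whenever `P ≥ 4`,
`x ≤ 6P`, `0 ≤ y ≤ P²`, `0 ≤ z ≤ 33 P²` (as `4·6·33 = 792 ≤ 4¹¹ ≤ P¹¹`).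
[Micciancio–Regev 2007, Thm. 5.23] [folklore] -/
theorem mr_bound_aux (P x y z : ℝ) (hP : 4 ≤ P) (hx : x ≤ 6 * P) (hy0 : 0 ≤ y)
    (hy : y ≤ P ^ 2) (hz0 : 0 ≤ z) (hz : z ≤ 33 * P ^ 2) : 4 * x * y * z ≤ P ^ 16 := by
  have hP0 : 0 ≤ P := by linarith
  calc 4 * x * y * z ≤ 4 * (6 * P) * P ^ 2 * (33 * P ^ 2) := by
        apply mul_le_mul _ hz hz0 (by positivity)
        apply mul_le_mul _ hy hy0 (by positivity)
        exact mul_le_mul_of_nonneg_left hx (by norm_num)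
    _ = 792 * P ^ 5 := by ring
    _ ≤ P ^ 11 * P ^ 5 := by
        apply mul_le_mul_of_nonneg_right _ (by positivity)
        calc (792 : ℝ) ≤ 4 ^ 11 := by norm_num
          _ ≤ P ^ 11 := pow_le_pow_left₀ (by norm_num) hP 11
    _ = P ^ 16 := by ring

/-- **The Micciancio–Regev modulus condition holds for the concrete parameters**:
`4 √(m(n)) · n √n · β(n) ≤ q(n)` for every `n`. With `P = 2^{logLen n} ≥ 4`, `P > n + 2`,
`logLen n ≤ P`: `m ≤ 32 P²`, `√m ≤ 6 P`, `β ≤ 33 P²`, `n √n ≤ P²`, so the left side is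
`≤ 792 P⁵ ≤ P¹⁶ = q`. [Micciancio–Regev 2007, Thm. 5.23] [cite: MicciancioRegev2007, Thm. 5.23] -/
theorem mrModulusCondition_params : Cryptography.MRModulusCondition modulus width normBound := by
  intro n
  have hu2 : 2 ≤ logLen n := two_le_logLen n
  have hP4 : (4 : ℝ) ≤ (2 : ℝ) ^ logLen n := by
    calc (4 : ℝ) = 2 ^ 2 := by norm_num
      _ ≤ 2 ^ logLen n := pow_le_pow_right₀ (by norm_num) hu2
  have hnP : (n : ℝ) + 2 ≤ (2 : ℝ) ^ logLen n := by
    have h : ((n + 2 : ℕ) : ℝ) ≤ ((2 ^ logLen n : ℕ) : ℝ) := by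
      exact_mod_cast (lt_two_pow_logLen n).le
    push_cast at h
    exact h
  have huP : (logLen n : ℝ) ≤ (2 : ℝ) ^ logLen n := by
    have h : ((logLen n : ℕ) : ℝ) ≤ ((2 ^ logLen n : ℕ) : ℝ) := by
      exact_mod_cast (logLen n).lt_two_pow_self.le
    push_cast at h
    exact h
  have hn0 : (0 : ℝ) ≤ n := Nat.cast_nonneg n
  have hm : (width n : ℝ) ≤ 32 * ((2 : ℝ) ^ logLen n) ^ 2 := by
    have h : (width n : ℝ) = 2 * n * (16 * logLen n) := by
      simp only [width, bitWidth, Nat.cast_mul, Nat.cast_ofNat]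
    rw [h]
    nlinarith
  have hm0 : (0 : ℝ) ≤ width n := Nat.cast_nonneg _
  have hsqm : Real.sqrt (width n) ≤ 6 * (2 : ℝ) ^ logLen n := by
    rw [Real.sqrt_le_left (by positivity)]
    nlinarith
  have hβ : normBound n ≤ 33 * ((2 : ℝ) ^ logLen n) ^ 2 := by
    unfold normBound; nlinarith
  have hsqn : Real.sqrt n ≤ (2 : ℝ) ^ logLen n := by
    rw [Real.sqrt_le_left (by positivity)]
    nlinarith
  have hnn : (n : ℝ) * Real.sqrt n ≤ ((2 : ℝ) ^ logLen n) ^ 2 := by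
    rw [sq]
    exact mul_le_mul (by linarith) hsqn (Real.sqrt_nonneg _) (by positivity)
  have hq : ((modulus n : ℕ) : ℝ) = ((2 : ℝ) ^ logLen n) ^ 16 := by
    simp only [modulus, bitWidth, Nat.cast_pow, Nat.cast_ofNat]
    rw [mul_comm, pow_mul]
  rw [hq]
  have hy0 : (0 : ℝ) ≤ (n : ℝ) * Real.sqrt n := mul_nonneg hn0 (Real.sqrt_nonneg _)
  have hz0 : (0 : ℝ) ≤ normBound n := zero_le_one.trans (one_le_normBound n)
  exact mr_bound_aux ((2 : ℝ) ^ logLen n) (Real.sqrt (width n)) ((n : ℝ) * Real.sqrt n)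
    (normBound n) hP4 hsqm hy0 hnn hz0 hβ

/-! ### Blocks of input lengths (the sets `dimOf⁻¹(n)`) -/

/-- `logLen` is monotone. [folklore] -/
theorem logLen_mono : Monotone logLen := fun _ _ h => Nat.log_mono_right (by omega)

/-- `bitWidth` is monotone. [folklore] -/
theorem bitWidth_mono : Monotone bitWidth := fun _ _ h => Nat.mul_le_mul_left 16 (logLen_mono h)

/-- `keyLen` is strictly increasing (so the blocks `dimOf⁻¹(n) = [keyLen n, keyLen (n+1))` are
nonempty intervals and every dimension occurs). [Goldreich 2001, §2.4.1] [cite: Goldreich2001, §2.4.1] -/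
theorem keyLen_strictMono : StrictMono keyLen := by
  refine strictMono_nat_of_lt_succ fun n => ?_
  have ht : bitWidth n ≤ bitWidth (n + 1) := bitWidth_mono (Nat.le_succ n)
  have h16 : 16 ≤ bitWidth n := sixteen_le_bitWidth n
  unfold keyLen width
  have h1 : n * (2 * n * bitWidth n) * bitWidth n ≤
      (n + 1) * (2 * (n + 1) * bitWidth (n + 1)) * bitWidth (n + 1) := by
    gcongr <;> omega
  have h2 : 2 * n * bitWidth n < 2 * (n + 1) * bitWidth (n + 1) := by nlinarith
  omega

/-- `k < keyLen (dimOf k + 1)`: the next dimension does not fit. [Goldreich 2001, §2.4.1] [cite: Goldreich2001, §2.4.1] -/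
theorem lt_keyLen_dimOf_succ (k : ℕ) : k < keyLen (dimOf k + 1) := by
  by_contra h
  push Not at h
  have := le_dimOf h
  omega

/-- The blocks of input lengths: `dimOf k = n ↔ keyLen n ≤ k < keyLen (n + 1)`.
[Goldreich 2001, §2.4.1 (length conventions)] [cite: Goldreich2001, §2.4.1] -/
theorem dimOf_eq_iff {k n : ℕ} : dimOf k = n ↔ keyLen n ≤ k ∧ k < keyLen (n + 1) := by
  constructor
  · rintro rfl
    exact ⟨keyLen_dimOf_le k, lt_keyLen_dimOf_succ k⟩
  · rintro ⟨h1, h2⟩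
    have h3 : n ≤ dimOf k := le_dimOf h1
    have h4 : dimOf k < n + 1 :=
      keyLen_strictMono.lt_iff_lt.1 ((keyLen_dimOf_le k).trans_lt h2)
    omega

/-- Every dimension occurs: `dimOf (keyLen n) = n`. [Goldreich 2001, §2.4.1] [cite: Goldreich2001, §2.4.1] -/
theorem dimOf_keyLen (n : ℕ) : dimOf (keyLen n) = n :=
  dimOf_eq_iff.2 ⟨le_rfl, keyLen_strictMono (Nat.lt_succ_self n)⟩

/-- `keyLen` is polynomially bounded (so each block `dimOf⁻¹(n) ⊆ [0, keyLen (n+1))` has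
polynomially many lengths, and security parameter and dimension are polynomially related).
[Goldreich 2001, §2.4.1; Micciancio–Regev 2007, Thm. 5.23 (`m, q = n^{O(1)}`)] [cite: Goldreich2001, §2.4.1] -/
theorem isPolyBounded_keyLen : IsPolyBounded keyLen := by
  refine ⟨Polynomial.X * (32 * Polynomial.X * (2 * Polynomial.X + 4)) *
      (16 * (2 * Polynomial.X + 4)) + 32 * Polynomial.X * (2 * Polynomial.X + 4), fun n => ?_⟩
  have hw : width n ≤ 32 * n * (2 * n + 4) := by
    unfold width bitWidth
    have := logLen_le n
    calc 2 * n * (16 * logLen n) = 32 * n * logLen n := by ring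
      _ ≤ 32 * n * (2 * n + 4) := Nat.mul_le_mul_left _ this
  have hb : bitWidth n ≤ 16 * (2 * n + 4) := by
    unfold bitWidth
    have := logLen_le n
    omega
  simp only [Polynomial.eval_add, Polynomial.eval_mul, Polynomial.eval_X, Polynomial.eval_ofNat]
  unfold keyLen
  gcongr

/-! ### The function -/

/-- The natural number with little-endian binary digits `l` (`false ↦ 0`, `true ↦ 1`); on
`t` uniformly random bits it is uniform on `[0, 2^t)`. [Arora–Barak 2009, §0.1] [cite: AroraBarak2009, §0.1] -/
def bitsToNat (l : List Bool) : ℕ := Nat.ofDigits 2 (l.map fun b => cond b 1 0)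

/-- Parse `A ∈ ℤ_{2^t}^{n×m}` from a bit string: entry `(i, j)` is read from the `t` bits at
offset `(i m + j) t` (missing bits read as absent, i.e. `0`). [Goldreich 2001, §2.4.2
(index sampling from uniform bits); Arora–Barak 2009, §0.1] [cite: Goldreich2001, §2.4.2] -/
def parseMatrix (n m t : ℕ) (w : List Bool) : Matrix (Fin n) (Fin m) (ZMod (2 ^ t)) :=
  Matrix.of fun i j => (bitsToNat ((w.drop (((i : ℕ) * m + j) * t)).take t) : ZMod (2 ^ t))

/-- Parse `x ∈ {0,1}^m ⊆ ℤ^m` from the `m` bits at offset `off` (missing bits read as `0`).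
[Ajtai 1996, Thm. 1 (inputs `x ∈ {0,1}^m`); Goldreich 2001, §2.4.2] [cite: Goldreich2001, §2.4.2] -/
def parseVec (off m : ℕ) (w : List Bool) : Fin m → ℤ :=
  fun j => if w.getD (off + j) false then 1 else 0

/-- Parsed vectors lie in the box `{0,1}^m`. [Ajtai 1996, Thm. 1] [folklore] -/
theorem inBox_parseVec (off m : ℕ) (w : List Bool) : InBox 2 (parseVec off m w) := by
  intro j
  unfold parseVec
  split_ifs <;> simp

/-- The bit string of a residue vector `v ∈ ℤ_qⁿ` (binary representatives,
`encodingFinVec encodingNatBool`). [Arora–Barak 2009, §0.1] [cite: AroraBarak2009, §0.1] -/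
def encodeResidues {n q : ℕ} (v : Fin n → ZMod q) : List Bool :=
  (encodingFinVec encodingNatBool n).encode fun i => (v i).val

/-- The keyed core of Ajtai's function on bit strings with explicit parameters `(n, m, t)`:
read `A ∈ ℤ_{2^t}^{n×m}` from the first `n m t` bits of `w` and `x ∈ {0,1}^m` from the next `m`
bits, keep the remaining bits (from position `n m t + m` on) as `pad`, and output
`boolPair (encodeMatrix A) (boolPair (encodeResidues (A x mod 2^t)) pad)`.
[Ajtai 1996, Thm. 1; Micciancio–Regev 2007, §5.1 (family `H_{q,m,2}`); Goldreich 2001,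
§2.4.2] [cite: MicciancioRegev2007, §5.1] -/
def sisFunctionWith (n m t : ℕ) (w : List Bool) : List Bool :=
  boolPair (encodeMatrix (parseMatrix n m t w))
    (boolPair (encodeResidues (hashFun (parseMatrix n m t w) (parseVec (n * m * t) m w)))
      (w.drop (n * m * t + m)))

/-- **Ajtai's SIS function as a single function on bit strings** (the one-way-function
candidate of `owfExist_of_gapSVP_worstCaseHard`). On `w ∈ {0,1}^k`: let `n = dimOf k`,
`m = width n`, `t = bitWidth n`, `q = 2^t = modulus n`; read `A ∈ ℤ_q^{n×m}` from the first
`n m t` bits and `x ∈ {0,1}^m` from the next `m` bits, keep the remaining bits as `pad`, and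
output `boolPair (encodeMatrix A) (boolPair (encodeResidues (A x mod q)) pad)`
(`sisFunctionWith`). On a uniformly random `w` the pair `(A, x)` is uniform, and a preimage of
`sisFunction w` is a triple `(A, x', pad)` of the same length with `A x' = A x (mod q)` (all
three components are recoverable from the output), i.e. `x' = x` or a collision of `f_A` on
`{0,1}^m`. [Ajtai 1996, Thm. 1; Micciancio–Regev 2007, §5.1 (family `H_{q,m,2}`); Goldreich
2001, §2.4.2 (a one-way collection as one function)] [cite: MicciancioRegev2007, §5.1 (family H_{q,m,d}); Ajtai 1996 Thm 1; Goldreich 2001 §2.4.2] -/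
def sisFunction (w : List Bool) : List Bool :=
  sisFunctionWith (dimOf w.length) (width (dimOf w.length)) (bitWidth (dimOf w.length)) w

/-- Unfolding lemma for `sisFunction`; note `keyLen n = n · width n · bitWidth n + width n` is
exactly the number of bits consumed before the padding. [folklore] -/
theorem sisFunction_eq (w : List Bool) :
    sisFunction w =
      sisFunctionWith (dimOf w.length) (width (dimOf w.length)) (bitWidth (dimOf w.length)) w :=
  rfl

/-! ### Structure of preimages of `sisFunction` -/

/-- `encodeResidues` is injective on `ℤ_qⁿ` for `q ≠ 0`. [folklore] -/
theorem encodeResidues_injective {n q : ℕ} [NeZero q] :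
    Function.Injective (encodeResidues : (Fin n → ZMod q) → List Bool) := by
  intro v w h
  have h1 := (encodingFinVec encodingNatBool n).encode_injective h
  funext i
  exact ZMod.val_injective _ (congr_fun h1 i)

/-- Outputs of `sisFunctionWith` determine the parameters `(n, m, t)` (they sit in the header
of `encodeMatrix`). [Goldreich 2001, §2.4.2; Arora–Barak 2009, §0.1] [cite: Goldreich2001, §2.4.2] -/
theorem params_eq_of_sisFunctionWith_eq {n₁ m₁ t₁ n₂ m₂ t₂ : ℕ} {z w : List Bool}
    (h : sisFunctionWith n₁ m₁ t₁ z = sisFunctionWith n₂ m₂ t₂ w) :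
    n₁ = n₂ ∧ m₁ = m₂ ∧ t₁ = t₂ := by
  have inj : ∀ a b : ℕ, encodeNat a = encodeNat b → a = b := fun a b hab => by
    simpa using congrArg decodeNat hab
  unfold sisFunctionWith encodeMatrix at h
  have e1 := (Prod.ext_iff.1 (boolPair_injective (a₁ := (_, _)) (a₂ := (_, _)) h)).1
  have e2 := Prod.ext_iff.1 (boolPair_injective (a₁ := (_, _)) (a₂ := (_, _)) e1)
  have e3 := Prod.ext_iff.1 (boolPair_injective (a₁ := (_, _)) (a₂ := (_, _)) e2.2)
  have e4 := Prod.ext_iff.1 (boolPair_injective (a₁ := (_, _)) (a₂ := (_, _)) e3.2)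
  exact ⟨inj _ _ e2.1, inj _ _ e3.1, Nat.pow_right_injective le_rfl (inj _ _ e4.1)⟩

/-- For fixed parameters, `sisFunctionWith n m t z = sisFunctionWith n m t w` says exactly: the
parsed keys agree (`A`), the images agree (`A x' = A x (mod 2^t)`, `x'`, `x` the parsed
vectors) and the paddings agree. [Ajtai 1996, Thm. 1; Goldreich 2001, §2.4.2] [cite: Goldreich2001, §2.4.2] -/
theorem sisFunctionWith_eq_iff {n m t : ℕ} {z w : List Bool} :
    sisFunctionWith n m t z = sisFunctionWith n m t w ↔
      parseMatrix n m t z = parseMatrix n m t w ∧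
      hashFun (parseMatrix n m t w) (parseVec (n * m * t) m z) =
        hashFun (parseMatrix n m t w) (parseVec (n * m * t) m w) ∧
      z.drop (n * m * t + m) = w.drop (n * m * t + m) := by
  haveI : NeZero (2 ^ t) := ⟨pow_ne_zero _ two_ne_zero⟩
  constructor
  · intro h
    unfold sisFunctionWith at h
    have e1 := Prod.ext_iff.1 (boolPair_injective (a₁ := (_, _)) (a₂ := (_, _)) h)
    have e2 := Prod.ext_iff.1 (boolPair_injective (a₁ := (_, _)) (a₂ := (_, _)) e1.2)
    have hA : parseMatrix n m t z = parseMatrix n m t w := encodeMatrix_injective e1.1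
    have hv := encodeResidues_injective e2.1
    rw [hA] at hv
    exact ⟨hA, hv, e2.2⟩
  · rintro ⟨hA, hv, hpad⟩
    unfold sisFunctionWith
    rw [hA, hv, hpad]

/-- **Preimages of `sisFunction` have the same length.** If `sisFunction z = sisFunction w` then
`|z| = |w|` (equal headers give the same dimension `n`, and the paddings, of lengths
`|z| - keyLen n`, `|w| - keyLen n`, agree). [Goldreich 2001, §2.4.1–2.4.2] [cite: Goldreich2001, §2.4.2] -/
theorem length_eq_of_sisFunction_eq {z w : List Bool} (h : sisFunction z = sisFunction w) :
    z.length = w.length := by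
  have hd : dimOf z.length = dimOf w.length := (params_eq_of_sisFunctionWith_eq h).1
  rw [sisFunction_eq, sisFunction_eq, hd] at h
  obtain ⟨-, -, hpad⟩ := sisFunctionWith_eq_iff.1 h
  have hz := keyLen_dimOf_le z.length
  have hw := keyLen_dimOf_le w.length
  have hl := congrArg List.length hpad
  simp only [List.length_drop] at hl
  rw [hd] at hz
  unfold keyLen at hz hw
  omega

/-- **Structure of preimages of Ajtai's packaged function.** `sisFunction z = sisFunction w`
iff `|z| = |w|` and, with `n = dimOf |w|`, `m = width n`, `t = bitWidth n`: `z` and `w` carry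
the same key `A ∈ ℤ_{2^t}^{n×m}`, the parsed vectors `x', x ∈ {0,1}^m` satisfy
`A x' = A x (mod 2^t)`, and the paddings agree. So an inverter, given `sisFunction w`, must
return the same `A` and `pad` together with an `f_A`-preimage `x' ∈ {0,1}^m` of `f_A x`.
[Ajtai 1996, Thm. 1; Goldreich 2001, §2.4.2 (a collection as one function)] [cite: Goldreich2001, §2.4.2] -/
theorem sisFunction_eq_iff {z w : List Bool} :
    sisFunction z = sisFunction w ↔ z.length = w.length ∧
      parseMatrix (dimOf w.length) (width (dimOf w.length)) (bitWidth (dimOf w.length)) z =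
        parseMatrix (dimOf w.length) (width (dimOf w.length)) (bitWidth (dimOf w.length)) w ∧
      hashFun (parseMatrix (dimOf w.length) (width (dimOf w.length)) (bitWidth (dimOf w.length)) w)
          (parseVec (dimOf w.length * width (dimOf w.length) * bitWidth (dimOf w.length))
            (width (dimOf w.length)) z) =
        hashFun (parseMatrix (dimOf w.length) (width (dimOf w.length)) (bitWidth (dimOf w.length)) w)
          (parseVec (dimOf w.length * width (dimOf w.length) * bitWidth (dimOf w.length))
            (width (dimOf w.length)) w) ∧
      z.drop (keyLen (dimOf w.length)) = w.drop (keyLen (dimOf w.length)) := by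
  constructor
  · intro h
    have hl := length_eq_of_sisFunction_eq h
    rw [sisFunction_eq, sisFunction_eq, hl] at h
    exact ⟨hl, sisFunctionWith_eq_iff.1 h⟩
  · rintro ⟨hl, h⟩
    rw [sisFunction_eq, sisFunction_eq, hl]
    exact sisFunctionWith_eq_iff.2 h

/-- **Inverting `sisFunction` means colliding `f_A` or returning `x`.** If `z` is any preimage
of `sisFunction w` (the success event `{z | f z = f w}` of `invertProb`, Goldreich Def. 2.2.1)
whose parsed vector `x'` differs from the parsed vector `x` of `w`, then `x - x'` is an SIS′
solution of norm `≤ √m` for the key `A` parsed from `w`. [Micciancio–Regev 2007, §5.1 (p. 18);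
Ajtai 1996, Thm. 1] [cite: MicciancioRegev2007, §5.1] -/
theorem isSolution'_of_sisFunction_eq {z w : List Bool} (h : sisFunction z = sisFunction w)
    (hne : parseVec (dimOf w.length * width (dimOf w.length) * bitWidth (dimOf w.length))
        (width (dimOf w.length)) z ≠
      parseVec (dimOf w.length * width (dimOf w.length) * bitWidth (dimOf w.length))
        (width (dimOf w.length)) w) :
    IsSolution' (parseMatrix (dimOf w.length) (width (dimOf w.length)) (bitWidth (dimOf w.length)) w)
      (Real.sqrt (width (dimOf w.length)))
      (parseVec (dimOf w.length * width (dimOf w.length) * bitWidth (dimOf w.length))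
          (width (dimOf w.length)) w -
        parseVec (dimOf w.length * width (dimOf w.length) * bitWidth (dimOf w.length))
          (width (dimOf w.length)) z) := by
  obtain ⟨-, -, hv, -⟩ := sisFunction_eq_iff.1 h
  exact isSolution'_sub_of_collision (inBox_parseVec _ _ w) (inBox_parseVec _ _ z) hne.symm hv.symm

/-! ### The counting half of the second-preimage argument (proved) -/

/-- `{0,1}`-vectors as integer vectors. [Ajtai 1996, Thm. 1 (inputs `x ∈ {0,1}^m`)] [folklore] -/
def boolVec {m : ℕ} (b : Fin m → Bool) : Fin m → ℤ := fun j => cond (b j) 1 0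

/-- `boolVec` is injective. [folklore] -/
theorem boolVec_injective (m : ℕ) : Function.Injective (boolVec (m := m)) := by
  intro b b' h
  funext j
  have := congr_fun h j
  cases hb : b j <;> cases hb' : b' j <;> simp_all [boolVec]

/-- `boolVec b ∈ {0,1}^m`. [folklore] -/
theorem inBox_boolVec {m : ℕ} (b : Fin m → Bool) : InBox 2 (boolVec b) := by
  intro j; unfold boolVec; cases b j <;> simp

/-- **At most `qⁿ` inputs are returned by any would-be inverter** (the counting half of
"an inverter of a compressing `f_A` yields collisions"): for every matrix `A ∈ ℤ_q^{n×m}` and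
every function `Inv` from images to candidate preimages (an inverter run with fixed coins),
the set of `x ∈ {0,1}^m` with `Inv (f_A x) = x` has at most `qⁿ` elements — on it `f_A` is
injective. Hence over a uniform `x ∈ {0,1}^m` the event "the inverter returns `x` itself" has
probability `≤ qⁿ/2^m`, and every other successful inversion is a collision, i.e. an SIS′
solution (`SIS.isSolution'_sub_of_collision`). [Ajtai 1996, Thm. 1; Micciancio–Regev 2007,
§5.1 (p. 18); Peikert 2016, §4.1.1 (pigeonhole bullet)] [cite: MicciancioRegev2007, §5.1] -/
theorem card_filter_inv_hashFun_le {n m q : ℕ} [NeZero q] (A : Matrix (Fin n) (Fin m) (ZMod q))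
    (Inv : (Fin n → ZMod q) → (Fin m → ℤ)) :
    (Finset.univ.filter fun b : Fin m → Bool => Inv (hashFun A (boolVec b)) = boolVec b).card
      ≤ q ^ n := by
  classical
  have hcard : (Finset.univ : Finset (Fin n → ZMod q)).card = q ^ n := by
    rw [Finset.card_univ, Fintype.card_fun, ZMod.card, Fintype.card_fin]
  rw [← hcard]
  refine Finset.card_le_card_of_injOn (fun b => hashFun A (boolVec b)) (fun _ _ => Finset.mem_univ _) ?_
  intro b hb b' hb' h
  simp only [Finset.coe_filter, Finset.mem_univ, true_and, Set.mem_setOf_eq] at hb hb'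
  apply boolVec_injective m
  have h' : hashFun A (boolVec b) = hashFun A (boolVec b') := h
  rw [← hb, ← hb', h']

open scoped Classical in
/-- **Successful inversions are self-returns or collisions** (the counting form of the
second-preimage argument behind "inverting a compressing `f_A` yields SIS′ solutions"): for
every `A ∈ ℤ_q^{n×m}` and every would-be inverter `Inv` (fixed key, padding and coins: a
function of the image alone), the number of `x ∈ {0,1}^m` on which `Inv` returns a preimage
`x' ∈ {0,1}^m` of `f_A x` is at most `qⁿ` (self-returns, `card_filter_inv_hashFun_le`) plus the
number of `x` for which `x - Inv (f_A x)` is an SIS′ solution of norm `≤ √m` (collisions,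
`isSolution'_sub_of_collision`). Dividing by `2^m`:
`Pr_x[x - x' solves SIS′] ≥ Pr_x[Inv inverts f_A at x] - qⁿ/2^m`. [Micciancio–Regev 2007, §5.1
(p. 18); Ajtai 1996, Thm. 1; Peikert 2016, §4.1.1] [cite: MicciancioRegev2007, §5.1] -/
theorem card_filter_invert_le {n m q : ℕ} [NeZero q] (A : Matrix (Fin n) (Fin m) (ZMod q))
    (Inv : (Fin n → ZMod q) → (Fin m → ℤ)) :
    (Finset.univ.filter fun b : Fin m → Bool =>
        InBox 2 (Inv (hashFun A (boolVec b))) ∧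
          hashFun A (Inv (hashFun A (boolVec b))) = hashFun A (boolVec b)).card
      ≤ q ^ n + (Finset.univ.filter fun b : Fin m → Bool =>
          IsSolution' A (Real.sqrt m) (boolVec b - Inv (hashFun A (boolVec b)))).card := by
  calc (Finset.univ.filter fun b : Fin m → Bool =>
        InBox 2 (Inv (hashFun A (boolVec b))) ∧
          hashFun A (Inv (hashFun A (boolVec b))) = hashFun A (boolVec b)).card
      ≤ ((Finset.univ.filter fun b : Fin m → Bool => Inv (hashFun A (boolVec b)) = boolVec b) ∪
          (Finset.univ.filter fun b : Fin m → Bool =>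
            IsSolution' A (Real.sqrt m) (boolVec b - Inv (hashFun A (boolVec b))))).card := by
        refine Finset.card_le_card ?_
        intro b hb
        simp only [Finset.mem_filter, Finset.mem_univ, true_and, Finset.mem_union] at hb ⊢
        by_cases h : Inv (hashFun A (boolVec b)) = boolVec b
        · exact Or.inl h
        · exact Or.inr
            (isSolution'_sub_of_collision (inBox_boolVec b) hb.1 (Ne.symm h) hb.2.symm)
    _ ≤ (Finset.univ.filter fun b : Fin m → Bool => Inv (hashFun A (boolVec b)) = boolVec b).card +
          (Finset.univ.filter fun b : Fin m → Bool =>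
            IsSolution' A (Real.sqrt m) (boolVec b - Inv (hashFun A (boolVec b)))).card :=
        Finset.card_union_le _ _
    _ ≤ q ^ n + (Finset.univ.filter fun b : Fin m → Bool =>
          IsSolution' A (Real.sqrt m) (boolVec b - Inv (hashFun A (boolVec b)))).card := by
        gcongr
        exact card_filter_inv_hashFun_le A Inv

open scoped Classical in
/-- The same in probability form over a uniform `x ∈ {0,1}^m` (divide by `2^m`):
`Pr_x[Inv inverts f_A at x within {0,1}^m] ≤ qⁿ/2^m + Pr_x[x - Inv (f_A x) solves SIS′_{√m}]`.
[Micciancio–Regev 2007, §5.1 (p. 18); Ajtai 1996, Thm. 1; Peikert 2016, §4.1.1] [cite: MicciancioRegev2007, §5.1] -/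
theorem prob_invert_le {n m q : ℕ} [NeZero q] (A : Matrix (Fin n) (Fin m) (ZMod q))
    (Inv : (Fin n → ZMod q) → (Fin m → ℤ)) :
    ((Finset.univ.filter fun b : Fin m → Bool =>
        InBox 2 (Inv (hashFun A (boolVec b))) ∧
          hashFun A (Inv (hashFun A (boolVec b))) = hashFun A (boolVec b)).card : ℝ) / 2 ^ m
      ≤ (q : ℝ) ^ n / 2 ^ m + ((Finset.univ.filter fun b : Fin m → Bool =>
          IsSolution' A (Real.sqrt m) (boolVec b - Inv (hashFun A (boolVec b)))).card : ℝ) / 2 ^ m := by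
  rw [← add_div]
  gcongr
  exact_mod_cast card_filter_invert_le A Inv

/-- **Binary collisions, hence SIS′ solutions, exist for compressing parameters** (pigeonhole;
MR07 §5.1 p. 18: "if `m(n) > n log_d q(n)` … by the pigeon hole principle, the functions `f_A`
are guaranteed to have collisions"; the `{0,1}^m` case of MR07 Lemma 5.2): if `qⁿ < 2^m` then
every `A ∈ ℤ_q^{n×m}` admits an SIS′ solution of norm `≤ √m`. [Micciancio–Regev 2007, §5.1
(p. 18) and Lemma 5.2 (p. 17); Peikert 2016, §4.1.1] [cite: MicciancioRegev2007, Lemma 5.2] -/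
theorem exists_isSolution'_of_pow_lt {n m q : ℕ} [NeZero q] (A : Matrix (Fin n) (Fin m) (ZMod q))
    (h : q ^ n < 2 ^ m) : ∃ z, IsSolution' A (Real.sqrt m) z := by
  classical
  have hcard : Fintype.card (Fin n → ZMod q) < Fintype.card (Fin m → Bool) := by
    simpa [Fintype.card_fun, ZMod.card] using h
  obtain ⟨b, b', hne, hcoll⟩ :=
    Fintype.exists_ne_map_eq_of_card_lt (fun b : Fin m → Bool => hashFun A (boolVec b)) hcard
  exact ⟨_, isSolution'_sub_of_collision (inBox_boolVec b) (inBox_boolVec b')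
    ((boolVec_injective m).ne hne) hcoll⟩

/-- Non-vacuity of the SIS′ ensemble for the concrete parameters: in every dimension `n ≥ 1`,
every `A ∈ ℤ_{q(n)}^{n×m(n)}` has an SIS′_{q,m,β} solution (`qⁿ = 2^{n t} < 2^{2 n t} = 2^m`,
`√m ≤ β`). [Micciancio–Regev 2007, Lemma 5.2 and §5.1] [cite: MicciancioRegev2007, Lemma 5.2] -/
theorem exists_isSolution'_params {n : ℕ} (hn : 1 ≤ n)
    (A : Matrix (Fin n) (Fin (width n)) (ZMod (modulus n))) :
    ∃ z, IsSolution' A (normBound n) z := by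
  have hlt : modulus n ^ n < 2 ^ width n := by
    unfold modulus width
    rw [← pow_mul]
    apply Nat.pow_lt_pow_right (by norm_num)
    have := sixteen_le_bitWidth n
    nlinarith
  obtain ⟨z, hz⟩ := exists_isSolution'_of_pow_lt A hlt
  exact ⟨z, hz.mono (sqrt_width_le_normBound n)⟩

end SIS

/-! ### Named facts about the concrete function -/

section PQC

open SIS

/-- NAMED FACT (TM2 level; nothing asserted). Ajtai's function `SIS.sisFunction` is
polynomial-time computable: computing `dimOf |w|`, parsing, the matrix–vector product modulo
`2^t` and the output code are polynomial-time string operations. [Ajtai 1996, Thm. 1 ("f_A is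
computable in polynomial time"); Arora–Barak 2009, §1.2–1.3 (robustness of polynomial time)] [cite: AroraBarak2009, §1.3] -/
def sisFunction_polyTimeComputable : Prop :=
  PolyTimeComputable id id sisFunction

/-- NAMED FACT (TM2 level; nothing asserted). The concrete parameters are polynomial-time
computable from `1ⁿ` (`modulus n = 2^{16 ⌊log₂(2n+4)⌋}` and `width n` in binary, and the
rational `normBound n = width n + 1`), i.e. `IsPolyTimeParams modulus normBound width`.
[Arora–Barak 2009, §1.3; Regev 2009, §3 (efficiently computable parameters)] [cite: AroraBarak2009, §1.3] -/
def sisParams_isPolyTimeParams : Prop :=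
  IsPolyTimeParams modulus normBound width

/-- NAMED FACT (**Ajtai 1996 Thm. 1 / Micciancio–Regev 2007 §5.1**, probabilistic core of the
SIS-function step; nothing is asserted). For every PPT `A` and exponent `c` there are a PPT `B`
and `c', k₀` such that for all `k ≥ k₀`: if `A` inverts `sisFunction` at security parameter `k`
with probability `≥ 1/kᶜ` (`invertProb`, Goldreich Def. 2.2.1), then `B` solves
SIS′_{q,m,β} (`q = modulus`, `m = width`, `β = normBound`) in dimension `n = dimOf k` on the
average with probability `≥ 1/n^{c'}`. `B` on `encodeMatrix A'` (uniform `A'`): guess a length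
`k'` uniformly in the block `dimOf⁻¹(n)` (polynomially many), sample `x ← {0,1}^m` and `pad`,
run `A` on `(1^{k'}, sisFunction (A', x, pad))`, parse `x'` from the answer and output the code
of `x - x'`; by `SIS.isSolution'_sub_of_collision` this is an SIS′ solution of norm
`≤ √m ≤ β` whenever `x' ≠ x` is a second preimage, and a genuine inverter returns `x' = x` with
probability at most `qⁿ/2^m = 2^{-n t(n)}` (there are at most `qⁿ` images). The sibling
`SISFunctionSolver.lean` writes `B` down (`SIS.sisSolver`, which also guesses `A`'s exact coin
count, only a bound being known) and PROVES this statement up to the polynomial running time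
of that explicit `B` (`Ajtai1996_sisFunction_core_of_solver`). [cite: MicciancioRegev2007, §5.1 (p. 18, collision remark); with Ajtai 1996 Thm 1] -/
def Ajtai1996_sisFunction_core : Prop :=
  ∀ A : RandAlg (List Bool) (List Bool), IsPPT A id → ∀ c : ℕ,
    ∃ B : RandAlg (List Bool) (List Bool), IsPPT B id ∧ ∃ c' k₀ : ℕ, ∀ k : ℕ, k₀ ≤ k →
      1 / (k : ℝ) ^ c ≤ invertProb sisFunction A k →
      1 / (dimOf k : ℝ) ^ c' ≤
        SIS.successProb' B (dimOf k) (width (dimOf k)) (modulus (dimOf k)) (normBound (dimOf k))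

end PQC

end Literature.Computability.Cryptography

end
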